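import Summits.Langlands.Langlands.Theses.DyadicOddResidue
import Literature.NumberTheory.Automorphic.CompletedCohomologyHeckeAlgebraGLn
import Literature.NumberTheory.Automorphic.FontaineMazurGL2OddPrime
import Literature.NumberTheory.GaloisRepresentations.OrdinaryTwistedDeterminant
import Summits.Langlands.Langlands.Theorems.DyadicOddResidueDyadicDihedralFMDictionary
import Summits.Langlands.Langlands.Theorems.DyadicOddResidueDyadicEisensteinFMSketchEngines
import Summits.Langlands.Langlands.Theorems.DyadicEisensteinFM.Negative.EisensteinResidueTraceCriterion

/-!
# Line `koch-pro2-fern` for the crux `DyadicOddResidue.DyadicEisensteinFM` (stmt-Langlands-18741) —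
# CHECKED SKELETON (crux-plan, planner-cruxplan-stmt-Langlands-18741-koch-pro2-fern-0, 2026-08-17, rev 1)

Source: idea card `Cruxes/DyadicEisensteinFM/Ideas/koch-pro2-fern.md` (merged by both triagers with
`koch-free-product-assembly`: TRIAGE-r1-1 / TRIAGE-r1-2, verdict `pass`, sharpenings (1)–(3) and (F1)–(F3)),
line card `Lines/koch-pro2-fern.md`.

THE LINE.  In the Eisenstein residue at `ℓ = 2` the lever is available exactly on the cell
`ρ̄^ss = χ̄ ⊕ χ̄` (all traces of `ρ` in `𝔪_{ℤ̄₂}`): after the odd-order twist `χ̄ = 1` the image of `ρ` is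
pro-`2`, so `ρ` factors through the KOCH-PRESENTED group `G_{ℚ,S}(2)` (`B_S = 0` over `ℚ`: `d = |S|`
generators, `r = |S| - 1` relations, ALL LOCAL; `G_{ℚ,{2,∞}}(2) = ℤ₂ ∗ ℤ/2`, Markšaitis; `D₂ = G` on the
free-product range, landed `Theorems.DyadicEisensteinFM.unique_prime_above_two`), the odd framed
deformation problem is an EXPLICIT local complete intersection of the `l₀ = 0` dimension, and
"big `R^{ps,red}[1/2] = 𝕋_𝔪`" (⟺ every such `ρ` is PRO-MODULAR, the Transfer `C⁺` of the card, stated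
pointwise below) is attacked WITHOUT Taylor–Wiles primes: at tame level `1` by Bellaïche's `R̄ = A = 𝔽₂⟦T₃,T₅⟧`
plus the landed Nakayama step `bijective_of_injective_mod_two` (triage F3); on the free-product range
`S = {2, q, ∞}`, `q ≡ ±3 (mod 8)` (`G = ℤ/2 ∗ G_{ℚ_q}(2)`, no global relation) by the Böckle–Pan dimension
criterion from one classical seed per component (triage r1-1 (3)); in general by the `2`-adic infinite fern
on the Koch c.i. (card K1–K3).  The exit is Pan II (any `p`): pro-modular + irreducible ⟹ pro-cohomological
(Pan, Forum Math. Pi 2022, Cor. 6.3.6 — stated for EVERY maximal ideal `𝔪` of `𝕋(K^p) ⊗ 𝒪`, p. 50 of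
arXiv:2008.07099 read, with Paškūnas–Tung 2021 for `p = 2`) ⟹ classical (arXiv:2209.06366 Thm. 1.1.2,
"Fix a prime number `p`") ⟹ the LANDED dictionary
`Theorems.DyadicDihedralFM.stub_dictionary` (newform ⟹ `L`-algebraic cuspidal `π`, every `ℓ`).

THE CUT (5 registered stubs; a PARTITION of the crux's scope into four cells + one shared exit):
* `stub_levelOneProModular`      — cell L1: `ρ` unramified away from `2` (tame level `1`; here `ρ̄^ss = 1 ⊕ 1`
  is automatic from `hres`: a character of `G_{ℚ,{2,∞}}` of odd order is trivial). [L; triage F3: PRINT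
  (Bellaïche CRAS 350 (2012); Bellaïche–Khare 2015) + landed Nakayama, determinant fixed weight by weight.]
* `stub_freeProductProModular`   — cell FP: unipotent residue, ramified at some odd place, unramified outside
  `{2, q}` for one prime `q ≡ ±3 (mod 8)` (`G_{ℚ,S}(2) = ℤ/2 ∗ G_{ℚ_q}(2)`). [XL; Koch free product + Böckle–Pan
  dimension criterion + one Eisenstein-congruent seed per inertial type at `q`.]
* `stub_unipotentProModular`     — cell U: unipotent residue, ramified at some odd place, NOT in the
  free-product range. [XL+, HARDEST: Koch presentation with linking relations (K1), `2`-adic positive-slope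
  fern at Eisenstein points (K2), seeds (K3).]
* `stub_distinguishedProModular` — cell D: `ρ̄^ss = χ̄₁ ⊕ χ̄₂`, `χ̄₁ ≠ χ̄₂` (some trace of `ρ` is a unit).
  CONCEDED COMPLEMENT: not a lemma of this lever — the route's own intended line (2-adic Skinner–Wiles ∪ Pan:
  residual Taylor–Wiles primes exist on this cell since `ℚ(χ̄₁/χ̄₂)` has odd degree) or card
  `close-approximation-cc`. [open]
* `stub_eisensteinClassicality`  — the shared exit: pro-modular + the crux's hypotheses ⟹ some Tate twist of
  `ρ` is the Galois representation of a newform (Pan II Thm 1.1.2 at `p = 2` + Cor. 6.3.6 at the Eisenstein `𝔪`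
  + the tree ↔ Pan Hecke-algebra dictionary, where irreducibility of `ρ` excludes the `H⁰`-supported points).
  [L; printed modulo glue — the Eisenstein twin of the vendored fact `Pan2022_proModularDeRhamClassical_GL2Q`.]
Composition `DyadicEisensteinFM_of` / `DyadicEisensteinFM_proof`: case split L1 / U∧FP / U∧¬FP / ¬U, then
exit + landed dictionary — pure logic, kernel-checked, no `sorry` of its own.

DISPROOF USED (`Cruxes/DyadicEisensteinFM/Disproof.lean`, cdisprove cycle 1, read 2026-08-17): NO KILL, no
`_false_without_<H>` theorem exists (§3: every hypothesis is load-bearing in nature but none is refutable);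
accordingly EVERY stub below carries the crux's hypotheses verbatim (nothing dropped), plus its cell.  §1b /
landed `Negative.EisensteinResidueTraceCriterion`: the cell-U hypothesis IMPLIES `hres` (sanity lemma
`hres_of_unipotentCell` below) — the cell is typed by the disprover's own trace criterion with `c = 0`.  §4
(`ConclusionForcesUnramified`): the exit keeps `hunr` (its conclusion re-implies it).  §0 (oddness residually
invisible): no stub splits by `ρ̄(c)`; oddness enters only through `t(c) = 0` inside the pro-modularity stubs.
No landed `Negative/*` lemma refutes an instance of any stub (they are structural: §0, §1b, §4 and `ω̄₂ = 1`).
-/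

set_option linter.dupNamespace false
set_option linter.unusedVariables false

noncomputable section

open scoped MatrixGroups ModularForm
open CongruenceSubgroup IsDedekindDomain NumberField Filter
open Summit.Langlands.Langlands.Theses.DyadicOddResidue
open Literature.NumberTheory.GaloisRepresentations Literature.NumberTheory.Automorphic

namespace Summit.Langlands.Langlands.Cruxes.DyadicEisensteinFM.KochPro2Fern

/-! ## 0. The cells (abbreviations used ONLY in the sanity lemmas and docstrings; the registered stub
signatures below are spelled out over tree vocabulary so that a Theorems-side `--supports` proof can restate
them textually) -/

/-- Cell **U** ("residually unipotent after the odd-order twist", `ρ̄^ss = χ̄ ⊕ χ̄`): every trace of `ρ` is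
an element of `ℤ̄_ℓ` lying in the maximal ideal — for `ℓ = 2`, `tr(χ̄ ⊕ χ̄) = 2χ̄ = 0`, and conversely
`χ̄₁ + χ̄₂ ≡ 0` forces `χ̄₁ = χ̄₂` (independence of characters).  The disprover's trace criterion with `c = 0`. -/
def UnipotentCell {ℓ : ℕ} [Fact ℓ.Prime] (ρ : FramedGaloisRep ℚ (PadicAlgCl ℓ) 2) : Prop :=
  ∀ g : Field.absoluteGaloisGroup ℚ, ∃ t : padicAlgClIntegers ℓ,
    (t : PadicAlgCl ℓ) = ((ρ g : GL (Fin 2) (PadicAlgCl ℓ)) : Matrix (Fin 2) (Fin 2) (PadicAlgCl ℓ)).trace ∧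
      t ∈ IsLocalRing.maximalIdeal (padicAlgClIntegers ℓ)

/-- Cell **L1** (tame level one, `S = {2, ∞}`, `G_{ℚ,S}(2) = ℤ₂ ∗ ℤ/2`): `ρ` is unramified at every finite
place not above `ℓ`. -/
def LevelOneCell {ℓ : ℕ} [Fact ℓ.Prime] (ρ : FramedGaloisRep ℚ (PadicAlgCl ℓ) 2) : Prop :=
  ∀ v : HeightOneSpectrum (𝓞 ℚ), ((ℓ : ℕ) : 𝓞 ℚ) ∉ v.asIdeal → ρ.IsUnramifiedAt v

/-- Cell **FP** (the free-product range, `S = {2, q, ∞}` with `q ≡ ±3 (mod 8)`, where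
`G_{ℚ,S}(2) = ℤ/2 ∗ G_{ℚ_q}(2)` and `D₂ = G_{ℚ,S}(2)`): `ρ` is unramified outside `{ℓ, q}` for one such `q`. -/
def FreeProductCell {ℓ : ℕ} [Fact ℓ.Prime] (ρ : FramedGaloisRep ℚ (PadicAlgCl ℓ) 2) : Prop :=
  ∃ q : ℕ, q.Prime ∧ (q % 8 = 3 ∨ q % 8 = 5) ∧
    ∀ v : HeightOneSpectrum (𝓞 ℚ), ((ℓ : ℕ) : 𝓞 ℚ) ∉ v.asIdeal → ((q : ℕ) : 𝓞 ℚ) ∉ v.asIdeal →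
      ρ.IsUnramifiedAt v

/-! ## 1. The statements of the five stubs, as named `Prop`s (`S.stub_*`; the registered `theorem stub_*`
below restate them verbatim — `stub_*_iff` — so that `DyadicEisensteinFM_of` takes them BY NAME) -/

/-- **S1 · cell L1 · pro-modularity at tame level one.**  For `ℓ = 2` and `ρ : Γ_ℚ → GL₂(ℚ̄₂)` with the
crux's hypotheses (residually not absolutely irreducible, irreducible, odd, de Rham at `2` with distinct
labelled Hodge–Tate weights) and unramified away from `2`, `ρ` is `2`-adically automorphic of some tame level
(a continuous `ℚ̄₂`-point of the completed-cohomology Hecke algebra, `TameLevel.IsPadicallyAutomorphic`).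
WHY PLAUSIBLE: `hres` + level `1` ⟹ `ρ̄^ss = 1 ⊕ 1` (odd-order characters of `G_{ℚ,{2,∞}}^{ab} = ℤ₂^×`
are trivial); image pro-`2` through `ℤ₂ ∗ ℤ/2`; with the determinant FIXED (`d = det ρ`, a `2`-adic weight)
the odd pseudo-deformation ring `R_d` surjects onto the weight-`d` tame-level-`1` `2`-adic Hecke algebra
`T_d` (torsion-free, local), injectively mod `ϖ` by Bellaïche's `R̄ ≅ A = 𝔽₂⟦T₃,T₅⟧` (CRAS 350 (2012);
Nicolas–Serre 2012), hence `R_d ≅ T_d` by the landed `bijective_of_injective_mod_two`; a point of `T_d` is a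
point of `𝕋(K^p)`, `K^p = GL₂(ℤ̂^{(2)})`.  No fern, no auxiliary prime.  WHY IT MIGHT FAIL: the exact
statement of [Bcras] (paywalled here, acq-01707) — constant-determinant char-2 ring vs `A`, and `t(c) = 0`;
the lift of every mod-2 level-1 form to 2-adic weight `d`. [Bellaiche2012CRAS, NicolasSerre2012,
BellaicheKhare2015, Medvedovsky arXiv:1707.09846 p.9, tree: bijective_of_injective_mod_two (p145036)] -/
def S.stub_levelOneProModular : Prop :=
  ∀ (ℓ : ℕ) [Fact ℓ.Prime], ℓ = 2 → ∀ (ρ : FramedGaloisRep ℚ (PadicAlgCl ℓ) 2),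
    ¬ ρ.IsResiduallyAbsIrreducible → ρ.toGaloisRep.IsIrreducible → ρ.IsOdd →
    (∀ (v : HeightOneSpectrum (𝓞 ℚ)) (hv : ((ℓ : ℕ) : 𝓞 ℚ) ∈ v.asIdeal),
      (Literature.NumberTheory.PAdicHodge.fontainePstAdicCompletion v ℓ hv).IsDeRhamFramed (ρ.toLocal v) ∧
      ∀ τ : v.adicCompletion ℚ →+* PadicAlgCl ℓ, Continuous τ →
        (ρ.labelledHodgeTateWeightsAt v (Literature.NumberTheory.PAdicHodge.fontainePstAdicCompletion v ℓ hv).algebra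
          (Literature.NumberTheory.PAdicHodge.fontainePstAdicCompletion v ℓ hv).𝔅 τ).Nodup) →
    (∀ v : HeightOneSpectrum (𝓞 ℚ), ((ℓ : ℕ) : 𝓞 ℚ) ∉ v.asIdeal → ρ.IsUnramifiedAt v) →
    ∃ 𝒰 : BigHeckeGLn.TameLevel 2 ℚ ℓ, 𝒰.IsPadicallyAutomorphic ρ

/-- **S2 · cell FP · pro-modularity on the free-product range.**  For `ℓ = 2` and `ρ` with the crux's
hypotheses, in the unipotent cell (all traces in `𝔪`), ramified at some odd place, and unramified outside
`{2, q}` for a prime `q ≡ ±3 (mod 8)`: `ρ` is `2`-adically automorphic of some tame level.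
WHY PLAUSIBLE: after the Teichmüller twist the image is pro-`2` through `G_{ℚ,{2,q,∞}}(2) = ℤ/2 ∗ G_{ℚ_q}(2)`
(`H¹`: `3 = 1 + 2` with kernel `{χ_d : d ∈ {2,q,2q} ∩ ℚ_q^{×2}} = ∅` iff `(2/q) = -1`; `H²`: `B_S = 0`, triage
r1-2), so the odd framed deformation ring is `R^□_∞ ⊗̂ R^□_q` with NO global relation: components = (odd
quadric, a domain `𝒪⟦a,b,c⟧/(a²+2a+bc)`) × (components of the local ring at `q`, DHKM 2020), all of the
`l₀ = 0` dimension; one classical Eisenstein-congruent seed of each inertial type at `q` (K3) + Pan's bound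
`dim 𝕋_𝔪 ≥ 3` (Pan 2022 §3 via PT21) ⟹ each component lies in `Spec 𝕋_𝔪` (Böckle's dimension criterion) —
no Coleman-family transversality needed (triage r1-1 (3)).  `D₂ = G` here, so every such `ρ` is irreducible
and non-ordinary at `2` (F1).  WHY IT MIGHT FAIL: the seed per `q`-type is an Eisenstein LEVEL-RAISING
statement mod `2` in varying weight (Ribet needs `ρ̄` irreducible; evidence j023214 only); smoothness of the
seed point on `Spec R^{ps}`. [Koch Encycl. 62 Thm 3.75/3.76 Ex. 25, Bockle2001, Pan2022 §3, PaskunasTung2021,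
DHKM2020 moduli of L-parameters, CalegariEmerton2005] -/
def S.stub_freeProductProModular : Prop :=
  ∀ (ℓ : ℕ) [Fact ℓ.Prime], ℓ = 2 → ∀ (ρ : FramedGaloisRep ℚ (PadicAlgCl ℓ) 2),
    ¬ ρ.IsResiduallyAbsIrreducible → ρ.toGaloisRep.IsIrreducible → ρ.IsOdd →
    (∀ᶠ v : HeightOneSpectrum (𝓞 ℚ) in cofinite, ρ.IsUnramifiedAt v) →
    (∀ (v : HeightOneSpectrum (𝓞 ℚ)) (hv : ((ℓ : ℕ) : 𝓞 ℚ) ∈ v.asIdeal),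
      (Literature.NumberTheory.PAdicHodge.fontainePstAdicCompletion v ℓ hv).IsDeRhamFramed (ρ.toLocal v) ∧
      ∀ τ : v.adicCompletion ℚ →+* PadicAlgCl ℓ, Continuous τ →
        (ρ.labelledHodgeTateWeightsAt v (Literature.NumberTheory.PAdicHodge.fontainePstAdicCompletion v ℓ hv).algebra
          (Literature.NumberTheory.PAdicHodge.fontainePstAdicCompletion v ℓ hv).𝔅 τ).Nodup) →
    (∀ g : Field.absoluteGaloisGroup ℚ, ∃ t : padicAlgClIntegers ℓ,
      (t : PadicAlgCl ℓ) = ((ρ g : GL (Fin 2) (PadicAlgCl ℓ)) : Matrix (Fin 2) (Fin 2) (PadicAlgCl ℓ)).trace ∧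
        t ∈ IsLocalRing.maximalIdeal (padicAlgClIntegers ℓ)) →
    ¬ (∀ v : HeightOneSpectrum (𝓞 ℚ), ((ℓ : ℕ) : 𝓞 ℚ) ∉ v.asIdeal → ρ.IsUnramifiedAt v) →
    (∃ q : ℕ, q.Prime ∧ (q % 8 = 3 ∨ q % 8 = 5) ∧
      ∀ v : HeightOneSpectrum (𝓞 ℚ), ((ℓ : ℕ) : 𝓞 ℚ) ∉ v.asIdeal → ((q : ℕ) : 𝓞 ℚ) ∉ v.asIdeal →
        ρ.IsUnramifiedAt v) →
    ∃ 𝒰 : BigHeckeGLn.TameLevel 2 ℚ ℓ, 𝒰.IsPadicallyAutomorphic ρ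

/-- **S3 · cell U (general tame level) · pro-modularity by the Koch-presented `2`-adic fern — THE HARDEST
STUB.**  For `ℓ = 2` and `ρ` with the crux's hypotheses, in the unipotent cell, ramified at some odd place and
NOT in the free-product range: `ρ` is `2`-adically automorphic of some tame level.
WHY PLAUSIBLE (card K1–K3 + K4's first half): `ρ` factors (after the Teichmüller twist) through the
Koch-presented `G_{ℚ,S}(2)` (`B_S = 0`: all `|S|-1` relations local, `t_∞² = 1`,
`t_q^{q-1}[t_q⁻¹,s_q⁻¹] = 1`), so the odd determinant-fixed pseudo-deformation space `𝔛_S` is an explicit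
complete intersection of expected rigid dimension `2`; (K1) its components through odd irreducible points
have exactly that dimension and are generically smooth (Fox calculus / `H²` by Mayer–Vietoris); (K3) each
contains a classical point smooth on `Spec R^{ps}_S`; (K2) the positive-slope `2`-adic fern (Buzzard–Kilford
eigencurve; two refinements through each classical crystalline point) or, where the dimension count is exact,
the Böckle–Pan criterion makes classical points Zariski-dense, i.e. `R^{ps,red}_S[1/2] ↪ 𝕋_𝔪`: every point —
`ρ` included — is pro-modular.  WHY IT MIGHT FAIL: for `|S_f| ≥ 2` the Frobenius lifts `s_q` are WORDS in
the other generators (linking numbers / Rédei symbols), so components of the global c.i. need not be products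
of local ones: an odd irreducible component of excess dimension or without a classical point kills density
(the PatchingLocalComponent moral "a component without a known point is invisible"); the fern at Eisenstein
points of the `2`-adic eigencurve is unverified in print. [GouveaMazur1998, Bockle2001, Chenevier2014,
BuzzardKilford2005, Deo2023 (arXiv:2105.05823), XZhang2025 (arXiv:2512.21249), Koch Encycl. 62 §3,
LabuteMinac2011, Pan2022] -/
def S.stub_unipotentProModular : Prop :=
  ∀ (ℓ : ℕ) [Fact ℓ.Prime], ℓ = 2 → ∀ (ρ : FramedGaloisRep ℚ (PadicAlgCl ℓ) 2),
    ¬ ρ.IsResiduallyAbsIrreducible → ρ.toGaloisRep.IsIrreducible → ρ.IsOdd →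
    (∀ᶠ v : HeightOneSpectrum (𝓞 ℚ) in cofinite, ρ.IsUnramifiedAt v) →
    (∀ (v : HeightOneSpectrum (𝓞 ℚ)) (hv : ((ℓ : ℕ) : 𝓞 ℚ) ∈ v.asIdeal),
      (Literature.NumberTheory.PAdicHodge.fontainePstAdicCompletion v ℓ hv).IsDeRhamFramed (ρ.toLocal v) ∧
      ∀ τ : v.adicCompletion ℚ →+* PadicAlgCl ℓ, Continuous τ →
        (ρ.labelledHodgeTateWeightsAt v (Literature.NumberTheory.PAdicHodge.fontainePstAdicCompletion v ℓ hv).algebra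
          (Literature.NumberTheory.PAdicHodge.fontainePstAdicCompletion v ℓ hv).𝔅 τ).Nodup) →
    (∀ g : Field.absoluteGaloisGroup ℚ, ∃ t : padicAlgClIntegers ℓ,
      (t : PadicAlgCl ℓ) = ((ρ g : GL (Fin 2) (PadicAlgCl ℓ)) : Matrix (Fin 2) (Fin 2) (PadicAlgCl ℓ)).trace ∧
        t ∈ IsLocalRing.maximalIdeal (padicAlgClIntegers ℓ)) →
    ¬ (∀ v : HeightOneSpectrum (𝓞 ℚ), ((ℓ : ℕ) : 𝓞 ℚ) ∉ v.asIdeal → ρ.IsUnramifiedAt v) →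
    ¬ (∃ q : ℕ, q.Prime ∧ (q % 8 = 3 ∨ q % 8 = 5) ∧
      ∀ v : HeightOneSpectrum (𝓞 ℚ), ((ℓ : ℕ) : 𝓞 ℚ) ∉ v.asIdeal → ((q : ℕ) : 𝓞 ℚ) ∉ v.asIdeal →
        ρ.IsUnramifiedAt v) →
    ∃ 𝒰 : BigHeckeGLn.TameLevel 2 ℚ ℓ, 𝒰.IsPadicallyAutomorphic ρ

/-- **S4 · cell D · pro-modularity in the residually distinguished cell — CONCEDED COMPLEMENT (not a lemma of
this lever).**  For `ℓ = 2` and `ρ` with the crux's hypotheses, ramified at some odd place and NOT in the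
unipotent cell (`ρ̄^ss = χ̄₁ ⊕ χ̄₂`, `χ̄₁ ≠ χ̄₂`: some trace is a unit): `ρ` is `2`-adically automorphic of
some tame level.  This is "big `R^{ps} = 𝕋` at the Eisenstein `𝔪`" on the cell where the route's intended
line IS viable: residual Taylor–Wiles / nice primes exist (`ℚ(χ̄₁/χ̄₂)` has odd degree, linearly disjoint
from `ℚ(ζ_{2^N})`), and `Frob` with distinct residual eigenvalues replaces complex conjugation in the
Skinner–Wiles / Bellaïche–Chenevier GMA splitting that `ρ̄(c) = 1` destroys (Disproof §0).  Alternative owner: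
card `close-approximation-cc` (Thorne 2026 Thm 2.12 + char-0 Taylor–Wiles).  WHY IT MIGHT FAIL: it is the
printed open question of Paškūnas–Tung §1.2 on this cell; `ω̄ = 1` makes the block at `2` exceptional.
[PaskunasTung2021 §1.2 p.6, Pan2022 Thm 1.0.2, SkinnerWiles1999, Thorne arXiv:2608.07186 Thm D (its ordinary
weight-{0,1} sub-cell is printed)] -/
def S.stub_distinguishedProModular : Prop :=
  ∀ (ℓ : ℕ) [Fact ℓ.Prime], ℓ = 2 → ∀ (ρ : FramedGaloisRep ℚ (PadicAlgCl ℓ) 2),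
    ¬ ρ.IsResiduallyAbsIrreducible → ρ.toGaloisRep.IsIrreducible → ρ.IsOdd →
    (∀ᶠ v : HeightOneSpectrum (𝓞 ℚ) in cofinite, ρ.IsUnramifiedAt v) →
    (∀ (v : HeightOneSpectrum (𝓞 ℚ)) (hv : ((ℓ : ℕ) : 𝓞 ℚ) ∈ v.asIdeal),
      (Literature.NumberTheory.PAdicHodge.fontainePstAdicCompletion v ℓ hv).IsDeRhamFramed (ρ.toLocal v) ∧
      ∀ τ : v.adicCompletion ℚ →+* PadicAlgCl ℓ, Continuous τ →
        (ρ.labelledHodgeTateWeightsAt v (Literature.NumberTheory.PAdicHodge.fontainePstAdicCompletion v ℓ hv).algebra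
          (Literature.NumberTheory.PAdicHodge.fontainePstAdicCompletion v ℓ hv).𝔅 τ).Nodup) →
    ¬ (∀ v : HeightOneSpectrum (𝓞 ℚ), ((ℓ : ℕ) : 𝓞 ℚ) ∉ v.asIdeal → ρ.IsUnramifiedAt v) →
    ¬ (∀ g : Field.absoluteGaloisGroup ℚ, ∃ t : padicAlgClIntegers ℓ,
      (t : PadicAlgCl ℓ) = ((ρ g : GL (Fin 2) (PadicAlgCl ℓ)) : Matrix (Fin 2) (Fin 2) (PadicAlgCl ℓ)).trace ∧
        t ∈ IsLocalRing.maximalIdeal (padicAlgClIntegers ℓ)) →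
    ∃ 𝒰 : BigHeckeGLn.TameLevel 2 ℚ ℓ, 𝒰.IsPadicallyAutomorphic ρ

/-- **S5 · the exit · classicality of pro-modular regular de Rham `ρ` at `2` in the Eisenstein residue.**  For
`ℓ = 2` and `ρ` with the crux's hypotheses which is `2`-adically automorphic of some tame level, some Tate
twist `ρ ⊗ ε₂^m` is the Galois representation of a newform `f ∈ S_k(Γ₁(N))` away from `N·2`
(`IsGaloisRepOfNewform1`) — the conclusion of the vendored fact `Pan2022_proModularDeRhamClassical_GL2Q`
VERBATIM, with its hypothesis "residually absolutely irreducible" replaced by the crux's "NOT".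
WHY PLAUSIBLE: Pan, Forum Math. Pi 10 (2022) Cor. 6.3.6 ("`ρ = ρ_λ` pro-modular and irreducible ⟹
`H̃¹(K^p, ℚ̄_p)[𝔭_λ] ≠ 0`", stated for EVERY maximal ideal `𝔪` of `𝕋(K^p) ⊗ 𝒪`, §6.3.4, with [PT21] for all
`p`) and Pan II, arXiv:2209.06366 Thm. 1.1.2 (any `p`; `ρ` absolutely irreducible over `E`, appears in `H̃¹`,
de Rham of weights `0 < k` ⟹ cuspidal eigenform of weight `k+1`), with the Tate twist moving `{a,b}` to
`{0,b-a}`.  Glue beyond print: a continuous point `x` of the tree's ALL-DEGREE, ALL-LEVEL algebra `𝕋(K^p)`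
associated with an IRREDUCIBLE `ρ` factors through the degree-one (Pan's) algebra `P`: `𝕋(K^p)` is a closed
subring of `Λ' × P` (`Λ'` = its image on the factors `H⁰(X_{U_r})` and on the torsion classes of the small
levels `U_r` with elliptic `2`- or `3`-torsion) surjecting onto both factors (dense image of a compact ring), so
`Spec 𝕋 = V(I_{Λ'}) ∪ V(I_P)` (`I_{Λ'} I_P = 0`); a point of `V(I_{Λ'})` has an Eisenstein eigensystem
`T_l ↦ (1+l)ψ(l)`, whose associated `ρ` would have semisimplification `ψ ⊕ ψε` (Chebotarev + Brauer–Nesbitt)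
— excluded by `hirr`; on `V(I_P)`, `x` IS a point `λ` of Pan's `𝕋(K^p)` and `ρ ≅ ρ_λ ⊗ ψ`.  WHY IT MIGHT
FAIL: only that glue at an Eisenstein `𝔪` (components `X_U` vs `Y`; the cusps' Eisenstein module in
`H¹(Y)/H¹(X)`; the Hecke eigensystems on the elliptic torsion classes of `H^i(Γ_{U_r}, ℤ/2^s)`, `r ≤ 1`, must be
shown Eisenstein) — the printed theorems impose no residual condition.
[Pan2022LocallyAnalyticII Thm 1.1.2/7.1.2 §7.2.1, Pan2022LocallyAnalytic Def 6.1.2 Cor 6.3.6, PaskunasTung2021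
Thm 7.1, CalegariEmerton2011, tree: Pan2022_proModularDeRhamClassical_GL2Q (the non-Eisenstein twin)] -/
def S.stub_eisensteinClassicality : Prop :=
  ∀ (ℓ : ℕ) [Fact ℓ.Prime], ℓ = 2 → ∀ (ρ : FramedGaloisRep ℚ (PadicAlgCl ℓ) 2),
    ¬ ρ.IsResiduallyAbsIrreducible → ρ.toGaloisRep.IsIrreducible → ρ.IsOdd →
    (∀ᶠ v : HeightOneSpectrum (𝓞 ℚ) in cofinite, ρ.IsUnramifiedAt v) →
    (∀ (v : HeightOneSpectrum (𝓞 ℚ)) (hv : ((ℓ : ℕ) : 𝓞 ℚ) ∈ v.asIdeal),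
      (Literature.NumberTheory.PAdicHodge.fontainePstAdicCompletion v ℓ hv).IsDeRhamFramed (ρ.toLocal v) ∧
      ∀ τ : v.adicCompletion ℚ →+* PadicAlgCl ℓ, Continuous τ →
        (ρ.labelledHodgeTateWeightsAt v (Literature.NumberTheory.PAdicHodge.fontainePstAdicCompletion v ℓ hv).algebra
          (Literature.NumberTheory.PAdicHodge.fontainePstAdicCompletion v ℓ hv).𝔅 τ).Nodup) →
    (∃ 𝒰 : BigHeckeGLn.TameLevel 2 ℚ ℓ, 𝒰.IsPadicallyAutomorphic ρ) →
    ∃ (χ : Field.absoluteGaloisGroup ℚ →ₜ* (PadicAlgCl ℓ)ˣ) (m : ℤ),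
      (∀ σ, χ σ = cyclotomicPadicAlgCl ℚ ℓ σ ^ m) ∧
      ∃ (N : ℕ) (_ : NeZero N) (k : ℤ) (f : CuspForm (Gamma1 N) k)
        (ιf : Literature.NumberTheory.EllipticCurves.ModularForms.coeffCharField f →+* PadicAlgCl ℓ),
        Literature.NumberTheory.EllipticCurves.ModularForms.IsNewform1 f ∧
        Literature.NumberTheory.EllipticCurves.ModularForms.IsGaloisRepOfNewform1 f ιf {q | q ∣ N * ℓ}
          (FramedRep.twist ρ χ)

/-! ## 2. The five REGISTERED stubs (the only `sorry`s of the line; statements = §1 verbatim, fully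
qualified, so that a Theorems-side `--supports stmt-Langlands-18741` proof can restate them textually) -/

/-- **stub_levelOneProModular** — registered form (statement = `S.stub_levelOneProModular`). [L] -/
theorem stub_levelOneProModular : ∀ (ℓ : ℕ) [Fact ℓ.Prime], ℓ = 2 → ∀ (ρ : Literature.NumberTheory.GaloisRepresentations.FramedGaloisRep ℚ (PadicAlgCl ℓ) 2), ¬ ρ.IsResiduallyAbsIrreducible → ρ.toGaloisRep.IsIrreducible → ρ.IsOdd → (∀ (v : IsDedekindDomain.HeightOneSpectrum (NumberField.RingOfIntegers ℚ)) (hv : ((ℓ : ℕ) : NumberField.RingOfIntegers ℚ) ∈ v.asIdeal), (Literature.NumberTheory.PAdicHodge.fontainePstAdicCompletion v ℓ hv).IsDeRhamFramed (ρ.toLocal v) ∧ ∀ τ : v.adicCompletion ℚ →+* PadicAlgCl ℓ, Continuous τ → (ρ.labelledHodgeTateWeightsAt v (Literature.NumberTheory.PAdicHodge.fontainePstAdicCompletion v ℓ hv).algebra (Literature.NumberTheory.PAdicHodge.fontainePstAdicCompletion v ℓ hv).𝔅 τ).Nodup) → (∀ v : IsDedekindDomain.HeightOneSpectrum (NumberField.RingOfIntegers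 ℚ), ((ℓ : ℕ) : NumberField.RingOfIntegers ℚ) ∉ v.asIdeal → ρ.IsUnramifiedAt v) → ∃ 𝒰 : Literature.NumberTheory.Automorphic.BigHeckeGLn.TameLevel 2 ℚ ℓ, 𝒰.IsPadicallyAutomorphic ρ := by
  sorry

/-- **stub_freeProductProModular** — registered form (statement = `S.stub_freeProductProModular`). [XL] -/
theorem stub_freeProductProModular : ∀ (ℓ : ℕ) [Fact ℓ.Prime], ℓ = 2 → ∀ (ρ : Literature.NumberTheory.GaloisRepresentations.FramedGaloisRep ℚ (PadicAlgCl ℓ) 2), ¬ ρ.IsResiduallyAbsIrreducible → ρ.toGaloisRep.IsIrreducible → ρ.IsOdd → (∀ᶠ v : IsDedekindDomain.HeightOneSpectrum (NumberField.RingOfIntegers ℚ) in Filter.cofinite, ρ.IsUnramifiedAt v) → (∀ (v : IsDedekindDomain.HeightOneSpectrum (NumberField.RingOfIntegers ℚ)) (hv : ((ℓ : ℕ) : NumberField.RingOfIntegers ℚ) ∈ v.asIdeal), (Literature.NumberTheory.PAdicHodge.fontainePstAdicCompletion v ℓ hv).IsDeRhamFramed (ρ.toLocal v) ∧ ∀ τ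 : v.adicCompletion ℚ →+* PadicAlgCl ℓ, Continuous τ → (ρ.labelledHodgeTateWeightsAt v (Literature.NumberTheory.PAdicHodge.fontainePstAdicCompletion v ℓ hv).algebra (Literature.NumberTheory.PAdicHodge.fontainePstAdicCompletion v ℓ hv).𝔅 τ).Nodup) → (∀ g : Field.absoluteGaloisGroup ℚ, ∃ t : Literature.NumberTheory.GaloisRepresentations.padicAlgClIntegers ℓ, (t : PadicAlgCl ℓ) = ((ρ g : Matrix.GeneralLinearGroup (Fin 2) (PadicAlgCl ℓ)) : Matrix (Fin 2) (Fin 2) (PadicAlgCl ℓ)).trace ∧ t ∈ IsLocalRing.maximalIdeal (Literature.NumberTheory.GaloisRepresentations.padicAlgClIntegers ℓ)) → ¬ (∀ v : IsDedekindDomain.HeightOneSpectrum (NumberField.RingOfIntegers ℚ), ((ℓ : ℕ) : NumberField.RingOfIntegers ℚ) ∉ v.asIdeal → ρ.IsUnramifiedAt v) → (∃ q : ℕ, q.Prime ∧ (q % 8 = 3 ∨ q % 8 = 5) ∧ ∀ v : IsDedekindDomain.HeightOneSpectrum (NumberField.RingOfIntegers ℚ), ((ℓ : ℕ) : NumberField.RingOfIntegers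 ℚ) ∉ v.asIdeal → ((q : ℕ) : NumberField.RingOfIntegers ℚ) ∉ v.asIdeal → ρ.IsUnramifiedAt v) → ∃ 𝒰 : Literature.NumberTheory.Automorphic.BigHeckeGLn.TameLevel 2 ℚ ℓ, 𝒰.IsPadicallyAutomorphic ρ := by
  sorry

/-- **stub_unipotentProModular** — registered form (statement = `S.stub_unipotentProModular`). [XL+, hardest] -/
theorem stub_unipotentProModular : ∀ (ℓ : ℕ) [Fact ℓ.Prime], ℓ = 2 → ∀ (ρ : Literature.NumberTheory.GaloisRepresentations.FramedGaloisRep ℚ (PadicAlgCl ℓ) 2), ¬ ρ.IsResiduallyAbsIrreducible → ρ.toGaloisRep.IsIrreducible → ρ.IsOdd → (∀ᶠ v : IsDedekindDomain.HeightOneSpectrum (NumberField.RingOfIntegers ℚ) in Filter.cofinite, ρ.IsUnramifiedAt v) → (∀ (v : IsDedekindDomain.HeightOneSpectrum (NumberField.RingOfIntegers ℚ)) (hv : ((ℓ : ℕ) : NumberField.RingOfIntegers ℚ) ∈ v.asIdeal), (Literature.NumberTheory.PAdicHodge.fontainePstAdicCompletion v ℓ hv).IsDeRhamFramed (ρ.toLocal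 v) ∧ ∀ τ : v.adicCompletion ℚ →+* PadicAlgCl ℓ, Continuous τ → (ρ.labelledHodgeTateWeightsAt v (Literature.NumberTheory.PAdicHodge.fontainePstAdicCompletion v ℓ hv).algebra (Literature.NumberTheory.PAdicHodge.fontainePstAdicCompletion v ℓ hv).𝔅 τ).Nodup) → (∀ g : Field.absoluteGaloisGroup ℚ, ∃ t : Literature.NumberTheory.GaloisRepresentations.padicAlgClIntegers ℓ, (t : PadicAlgCl ℓ) = ((ρ g : Matrix.GeneralLinearGroup (Fin 2) (PadicAlgCl ℓ)) : Matrix (Fin 2) (Fin 2) (PadicAlgCl ℓ)).trace ∧ t ∈ IsLocalRing.maximalIdeal (Literature.NumberTheory.GaloisRepresentations.padicAlgClIntegers ℓ)) → ¬ (∀ v : IsDedekindDomain.HeightOneSpectrum (NumberField.RingOfIntegers ℚ), ((ℓ : ℕ) : NumberField.RingOfIntegers ℚ) ∉ v.asIdeal → ρ.IsUnramifiedAt v) → ¬ (∃ q : ℕ, q.Prime ∧ (q % 8 = 3 ∨ q % 8 = 5) ∧ ∀ v : IsDedekindDomain.HeightOneSpectrum (NumberField.RingOfIntegers ℚ), ((ℓ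 : ℕ) : NumberField.RingOfIntegers ℚ) ∉ v.asIdeal → ((q : ℕ) : NumberField.RingOfIntegers ℚ) ∉ v.asIdeal → ρ.IsUnramifiedAt v) → ∃ 𝒰 : Literature.NumberTheory.Automorphic.BigHeckeGLn.TameLevel 2 ℚ ℓ, 𝒰.IsPadicallyAutomorphic ρ := by
  sorry

/-- **stub_distinguishedProModular** — registered form (statement = `S.stub_distinguishedProModular`).
[open problem; CONCEDED COMPLEMENT — the route's 2-adic Skinner–Wiles ∪ Pan line, not a lemma of this lever.] -/
theorem stub_distinguishedProModular : ∀ (ℓ : ℕ) [Fact ℓ.Prime], ℓ = 2 → ∀ (ρ : Literature.NumberTheory.GaloisRepresentations.FramedGaloisRep ℚ (PadicAlgCl ℓ) 2), ¬ ρ.IsResiduallyAbsIrreducible → ρ.toGaloisRep.IsIrreducible → ρ.IsOdd → (∀ᶠ v : IsDedekindDomain.HeightOneSpectrum (NumberField.RingOfIntegers ℚ) in Filter.cofinite, ρ.IsUnramifiedAt v) → (∀ (v : IsDedekindDomain.HeightOneSpectrum (NumberField.RingOfIntegers ℚ)) (hv : ((ℓ : ℕ) : NumberField.RingOfIntegers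 ℚ) ∈ v.asIdeal), (Literature.NumberTheory.PAdicHodge.fontainePstAdicCompletion v ℓ hv).IsDeRhamFramed (ρ.toLocal v) ∧ ∀ τ : v.adicCompletion ℚ →+* PadicAlgCl ℓ, Continuous τ → (ρ.labelledHodgeTateWeightsAt v (Literature.NumberTheory.PAdicHodge.fontainePstAdicCompletion v ℓ hv).algebra (Literature.NumberTheory.PAdicHodge.fontainePstAdicCompletion v ℓ hv).𝔅 τ).Nodup) → ¬ (∀ v : IsDedekindDomain.HeightOneSpectrum (NumberField.RingOfIntegers ℚ), ((ℓ : ℕ) : NumberField.RingOfIntegers ℚ) ∉ v.asIdeal → ρ.IsUnramifiedAt v) → ¬ (∀ g : Field.absoluteGaloisGroup ℚ, ∃ t : Literature.NumberTheory.GaloisRepresentations.padicAlgClIntegers ℓ, (t : PadicAlgCl ℓ) = ((ρ g : Matrix.GeneralLinearGroup (Fin 2) (PadicAlgCl ℓ)) : Matrix (Fin 2) (Fin 2) (PadicAlgCl ℓ)).trace ∧ t ∈ IsLocalRing.maximalIdeal (Literature.NumberTheory.GaloisRepresentations.padicAlgClIntegers ℓ)) → ∃ 𝒰 : Literature.NumberTheory.Automorphic.BigHeckeGLn.TameLevel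 2 ℚ ℓ, 𝒰.IsPadicallyAutomorphic ρ := by
  sorry

/-- **stub_eisensteinClassicality** — registered form (statement = `S.stub_eisensteinClassicality`). [L] -/
theorem stub_eisensteinClassicality : ∀ (ℓ : ℕ) [Fact ℓ.Prime], ℓ = 2 → ∀ (ρ : Literature.NumberTheory.GaloisRepresentations.FramedGaloisRep ℚ (PadicAlgCl ℓ) 2), ¬ ρ.IsResiduallyAbsIrreducible → ρ.toGaloisRep.IsIrreducible → ρ.IsOdd → (∀ᶠ v : IsDedekindDomain.HeightOneSpectrum (NumberField.RingOfIntegers ℚ) in Filter.cofinite, ρ.IsUnramifiedAt v) → (∀ (v : IsDedekindDomain.HeightOneSpectrum (NumberField.RingOfIntegers ℚ)) (hv : ((ℓ : ℕ) : NumberField.RingOfIntegers ℚ) ∈ v.asIdeal), (Literature.NumberTheory.PAdicHodge.fontainePstAdicCompletion v ℓ hv).IsDeRhamFramed (ρ.toLocal v) ∧ ∀ τ : v.adicCompletion ℚ →+* PadicAlgCl ℓ, Continuous τ → (ρ.labelledHodgeTateWeightsAt v (Literature.NumberTheory.PAdicHodge.fontainePstAdicCompletion v ℓ hv).algebra (Literature.NumberTheory.PAdicHodge.fontainePstAdicCompletion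 v ℓ hv).𝔅 τ).Nodup) → (∃ 𝒰 : Literature.NumberTheory.Automorphic.BigHeckeGLn.TameLevel 2 ℚ ℓ, 𝒰.IsPadicallyAutomorphic ρ) → ∃ (χ : Field.absoluteGaloisGroup ℚ →ₜ* (PadicAlgCl ℓ)ˣ) (m : ℤ), (∀ σ, χ σ = Literature.NumberTheory.GaloisRepresentations.cyclotomicPadicAlgCl ℚ ℓ σ ^ m) ∧ ∃ (N : ℕ) (_ : NeZero N) (k : ℤ) (f : CuspForm (CongruenceSubgroup.Gamma1 N) k) (ιf : Literature.NumberTheory.EllipticCurves.ModularForms.coeffCharField f →+* PadicAlgCl ℓ), Literature.NumberTheory.EllipticCurves.ModularForms.IsNewform1 f ∧ Literature.NumberTheory.EllipticCurves.ModularForms.IsGaloisRepOfNewform1 f ιf {q | q ∣ N * ℓ} (Literature.NumberTheory.GaloisRepresentations.FramedRep.twist ρ χ) := by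
  sorry

/-! ## 3. Sanity lemmas (proved): registered forms ARE the `S.stub_*` statements; the cells sit inside the
crux's scope; the unipotent cell implies `hres` (the disprover's trace criterion, landed Negative lemma) -/

theorem stub_levelOneProModular_iff : S.stub_levelOneProModular ↔ (∀ (ℓ : ℕ) [Fact ℓ.Prime], ℓ = 2 → ∀ (ρ : Literature.NumberTheory.GaloisRepresentations.FramedGaloisRep ℚ (PadicAlgCl ℓ) 2), ¬ ρ.IsResiduallyAbsIrreducible → ρ.toGaloisRep.IsIrreducible → ρ.IsOdd → (∀ (v : IsDedekindDomain.HeightOneSpectrum (NumberField.RingOfIntegers ℚ)) (hv : ((ℓ : ℕ) : NumberField.RingOfIntegers ℚ) ∈ v.asIdeal), (Literature.NumberTheory.PAdicHodge.fontainePstAdicCompletion v ℓ hv).IsDeRhamFramed (ρ.toLocal v) ∧ ∀ τ : v.adicCompletion ℚ →+* PadicAlgCl ℓ, Continuous τ → (ρ.labelledHodgeTateWeightsAt v (Literature.NumberTheory.PAdicHodge.fontainePstAdicCompletion v ℓ hv).algebra (Literature.NumberTheory.PAdicHodge.fontainePstAdicCompletion v ℓ hv).𝔅 τ).Nodup) →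 (∀ v : IsDedekindDomain.HeightOneSpectrum (NumberField.RingOfIntegers ℚ), ((ℓ : ℕ) : NumberField.RingOfIntegers ℚ) ∉ v.asIdeal → ρ.IsUnramifiedAt v) → ∃ 𝒰 : Literature.NumberTheory.Automorphic.BigHeckeGLn.TameLevel 2 ℚ ℓ, 𝒰.IsPadicallyAutomorphic ρ) :=
  Iff.rfl

theorem stub_eisensteinClassicality_iff : S.stub_eisensteinClassicality ↔ (∀ (ℓ : ℕ) [Fact ℓ.Prime], ℓ = 2 → ∀ (ρ : Literature.NumberTheory.GaloisRepresentations.FramedGaloisRep ℚ (PadicAlgCl ℓ) 2), ¬ ρ.IsResiduallyAbsIrreducible → ρ.toGaloisRep.IsIrreducible → ρ.IsOdd → (∀ᶠ v : IsDedekindDomain.HeightOneSpectrum (NumberField.RingOfIntegers ℚ) in Filter.cofinite, ρ.IsUnramifiedAt v) → (∀ (v : IsDedekindDomain.HeightOneSpectrum (NumberField.RingOfIntegers ℚ)) (hv : ((ℓ : ℕ) : NumberField.RingOfIntegers ℚ) ∈ v.asIdeal), (Literature.NumberTheory.PAdicHodge.fontainePstAdicCompletion v ℓ hv).IsDeRhamFramed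 (ρ.toLocal v) ∧ ∀ τ : v.adicCompletion ℚ →+* PadicAlgCl ℓ, Continuous τ → (ρ.labelledHodgeTateWeightsAt v (Literature.NumberTheory.PAdicHodge.fontainePstAdicCompletion v ℓ hv).algebra (Literature.NumberTheory.PAdicHodge.fontainePstAdicCompletion v ℓ hv).𝔅 τ).Nodup) → (∃ 𝒰 : Literature.NumberTheory.Automorphic.BigHeckeGLn.TameLevel 2 ℚ ℓ, 𝒰.IsPadicallyAutomorphic ρ) → ∃ (χ : Field.absoluteGaloisGroup ℚ →ₜ* (PadicAlgCl ℓ)ˣ) (m : ℤ), (∀ σ, χ σ = Literature.NumberTheory.GaloisRepresentations.cyclotomicPadicAlgCl ℚ ℓ σ ^ m) ∧ ∃ (N : ℕ) (_ : NeZero N) (k : ℤ) (f : CuspForm (CongruenceSubgroup.Gamma1 N) k) (ιf : Literature.NumberTheory.EllipticCurves.ModularForms.coeffCharField f →+* PadicAlgCl ℓ), Literature.NumberTheory.EllipticCurves.ModularForms.IsNewform1 f ∧ Literature.NumberTheory.EllipticCurves.ModularForms.IsGaloisRepOfNewform1 f ιf {q | q ∣ N * ℓ} (Literature.NumberTheory.GaloisRepresentations.FramedRep.twist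 ρ χ)) :=
  Iff.rfl

/-- **Cell U ⟹ `hres`** (Disproof §1b, landed `Negative.EisensteinResidueTraceCriterion` with `c = 0`): on the
unipotent cell the crux's residual hypothesis is automatic — the cell is typed by the disprover's own
criterion, so S2/S3 carry `hres` only for uniformity. -/
theorem hres_of_unipotentCell {ℓ : ℕ} [Fact ℓ.Prime] (ρ : FramedGaloisRep ℚ (PadicAlgCl ℓ) 2)
    (hU : UnipotentCell ρ) : ¬ ρ.IsResiduallyAbsIrreducible := by
  refine Summit.Langlands.Langlands.Theorems.DyadicEisensteinFM.Negative.not_isResiduallyAbsIrreducible_of_trace_sub_mem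
    ρ 0 fun g => ?_
  obtain ⟨t, ht, hmem⟩ := hU g
  exact ⟨t, ht, by simpa using hmem⟩

/-- **Cell L1 ⊂ the crux's scope**: unramified away from `ℓ` ⟹ unramified at cofinitely many places (landed
`Theorems.DyadicEisensteinFM.finite_places_above`). -/
theorem aeUnramified_of_levelOneCell {ℓ : ℕ} [Fact ℓ.Prime] (ρ : FramedGaloisRep ℚ (PadicAlgCl ℓ) 2)
    (h : LevelOneCell ρ) : ∀ᶠ v : HeightOneSpectrum (𝓞 ℚ) in cofinite, ρ.IsUnramifiedAt v := by
  rw [Filter.eventually_cofinite]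
  refine (Summit.Langlands.Langlands.Theorems.DyadicEisensteinFM.finite_places_above ℓ).subset ?_
  intro v hv
  by_contra hv'
  exact hv (h v hv')

/-- **Cell FP ⊂ the crux's scope**: unramified outside `{ℓ, q}` ⟹ unramified at cofinitely many places. -/
theorem aeUnramified_of_freeProductCell {ℓ : ℕ} [Fact ℓ.Prime] (ρ : FramedGaloisRep ℚ (PadicAlgCl ℓ) 2)
    (h : FreeProductCell ρ) : ∀ᶠ v : HeightOneSpectrum (𝓞 ℚ) in cofinite, ρ.IsUnramifiedAt v := by
  obtain ⟨q, hq, -, hunr⟩ := h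
  haveI : Fact q.Prime := ⟨hq⟩
  rw [Filter.eventually_cofinite]
  refine ((Summit.Langlands.Langlands.Theorems.DyadicEisensteinFM.finite_places_above ℓ).union
    (Summit.Langlands.Langlands.Theorems.DyadicEisensteinFM.finite_places_above q)).subset ?_
  intro v hv
  by_contra hv'
  simp only [Set.mem_union, Set.mem_setOf_eq, not_or] at hv'
  exact hv (hunr v hv'.1 hv'.2)

/-- The free-product congruence class is decidable bookkeeping: `3`, `5`, `11`, `13` qualify; `7`, `17` do not
(the controls of triage (F1): `14a1`, `17a1` are ordinary Eisenstein-residue points OUTSIDE the range). -/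
example : (3 % 8 = 3 ∨ 3 % 8 = 5) ∧ (5 % 8 = 3 ∨ 5 % 8 = 5) ∧ (11 % 8 = 3 ∨ 11 % 8 = 5) ∧
    (13 % 8 = 3 ∨ 13 % 8 = 5) ∧ ¬ (7 % 8 = 3 ∨ 7 % 8 = 5) ∧ ¬ (17 % 8 = 3 ∨ 17 % 8 = 5) := by decide

/-! ## 4. The composition: the five stubs imply the crux BY NAME (kernel-checked, no `sorry` of its own) -/

/-- **The line concludes the crux.**  Pro-modularity of `ρ` by the cell partition — L1 (S1); else U ∧ FP (S2);
else U ∧ ¬FP (S3); else ¬U (S4) — then the exit S5 (classicality at the Eisenstein `𝔪`, `p = 2`) and the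
LANDED dictionary `Theorems.DyadicDihedralFM.stub_dictionary` (newform ⟹ `L`-algebraic cuspidal `π`,
Satake–Frobenius compatible a.e.).  Every hypothesis of the crux is consumed (Disproof §3: none is droppable). -/
theorem DyadicEisensteinFM_of (h₁ : S.stub_levelOneProModular) (h₂ : S.stub_freeProductProModular)
    (h₃ : S.stub_unipotentProModular) (h₄ : S.stub_distinguishedProModular)
    (h₅ : S.stub_eisensteinClassicality) :
    Summit.Langlands.Langlands.Theses.DyadicOddResidue.DyadicEisensteinFM := by
  intro ℓ _ hℓ ρ hres hirr hodd hunr hdR hcpt ι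
  have hpm : ∃ 𝒰 : BigHeckeGLn.TameLevel 2 ℚ ℓ, 𝒰.IsPadicallyAutomorphic ρ := by
    by_cases hL1 : ∀ v : HeightOneSpectrum (𝓞 ℚ), ((ℓ : ℕ) : 𝓞 ℚ) ∉ v.asIdeal → ρ.IsUnramifiedAt v
    · exact h₁ ℓ hℓ ρ hres hirr hodd hdR hL1
    · by_cases hU : ∀ g : Field.absoluteGaloisGroup ℚ, ∃ t : padicAlgClIntegers ℓ,
          (t : PadicAlgCl ℓ) =
              ((ρ g : GL (Fin 2) (PadicAlgCl ℓ)) : Matrix (Fin 2) (Fin 2) (PadicAlgCl ℓ)).trace ∧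
            t ∈ IsLocalRing.maximalIdeal (padicAlgClIntegers ℓ)
      · by_cases hFP : ∃ q : ℕ, q.Prime ∧ (q % 8 = 3 ∨ q % 8 = 5) ∧
            ∀ v : HeightOneSpectrum (𝓞 ℚ), ((ℓ : ℕ) : 𝓞 ℚ) ∉ v.asIdeal → ((q : ℕ) : 𝓞 ℚ) ∉ v.asIdeal →
              ρ.IsUnramifiedAt v
        · exact h₂ ℓ hℓ ρ hres hirr hodd hunr hdR hU hL1 hFP
        · exact h₃ ℓ hℓ ρ hres hirr hodd hunr hdR hU hL1 hFP
      · exact h₄ ℓ hℓ ρ hres hirr hodd hunr hdR hL1 hU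
  exact Summit.Langlands.Langlands.Theorems.DyadicDihedralFM.stub_dictionary ℓ ρ
    (h₅ ℓ hℓ ρ hres hirr hodd hunr hdR hpm) hcpt ι

/-- **The skeleton**: the crux modulo exactly the five registered stubs (sorries live only inside `stub_*`). -/
theorem DyadicEisensteinFM_proof :
    Summit.Langlands.Langlands.Theses.DyadicOddResidue.DyadicEisensteinFM :=
  DyadicEisensteinFM_of stub_levelOneProModular stub_freeProductProModular stub_unipotentProModular
    stub_distinguishedProModular stub_eisensteinClassicality

end Summit.Langlands.Langlands.Cruxes.DyadicEisensteinFM.KochPro2Fern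

end
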